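import Literature.NumberTheory.GaloisRepresentations.LubinTateColemanLogDerivLimit
import Literature.NumberTheory.GaloisRepresentations.LubinTateColemanTraceEquivariant
import Literature.NumberTheory.GaloisRepresentations.LubinTateColemanInterpolation
import HarnessLib

/-!
# `h ↦ h̃ = h − u·(h ∘ f)`: from the `𝒮`-eigenseries `𝓔_π` to the trace-zero series

De Shalit, *Iwasawa theory of elliptic curves with complex multiplication* (1987), Ch. I §3.3 (7'), §3.13–3.14: for
`𝒮h = h^φ` the series `h̃ = h − h^φ ∘ [p]` is the power series of a measure on the units, and conversely (Lemma 3.13);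
this is the step `𝓔 ≅ ker(j)` of the structure theorem I.3.7 for `𝒰`.  The underlying power-series algebra, for
`f = πX + X^q` over `𝒪[F]` (`F` any non-archimedean local field, `q = |𝓀_F|`) and a constant `u ∈ 𝒪[F]`:

* ★ `colemanTrace_subst_ltSer` — **`𝒮(h ∘ f) = q · h`**.
* ★ `subst_ltSer_mem_adicFilt_succ` — `d ∈ I_N`, `d(0) = 0 ⟹ d ∘ f ∈ I_{N+1}` (`I_N` = `adicFilt π N`);
  `exists_forall_sub_mem_adicFilt` — `(π, X)`-adic Cauchy sequences converge.
* ★★ `exists_eq_add_C_mul_subst` / `eq_of_eq_add_C_mul_subst` — for `g(0) = 0`, **`h = g + u · (h ∘ f)`** has a unique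
  solution with `h(0) = 0`; `colemanTrace_eq_of_eq_add_C_mul_subst` — then `𝒮h = 𝒮g + (u q) · h`, so for
  **`π = q·u`** (e.g. `F = ℚ_p`): `𝒮h = π h ⟺ 𝒮g = 0`.
* ★★★ `tildeSer π u h = h − u·(h ∘ f)`; `colemanTrace_tildeSer_eq_zero`, `existsUnique_tildeSer_eq` — for `π = q u`,
  `h ↦ h̃` maps `𝓔_π = {𝒮h = πh}` into `{𝒮g = 0}`, and **every `g` with `𝒮g = 0`, `g(0) = 0` is `h̃` for a unique
  `h ∈ 𝓔_π` with `h(0) = 0`** (Lemma 3.13 and the injectivity of 3.14, power-series form).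

Composed with `δ : 𝒰 ≅ 𝓔_π` (`LubinTateColemanLogDerivSurjTwo`) this carries the norm-coherent units of the Lubin–Tate
tower onto the trace-zero series (the avatar of `𝒪⟦ℤ_p^×⟧`); no measures are introduced here.  0 sorry.

## References

* E. de Shalit, *Iwasawa theory of elliptic curves with complex multiplication* (1987), Ch. I §3.3, §3.13–3.14. [deShalit1987]
* R. Coleman, *Division values in local fields*, Invent. Math. 53 (1979), §III. [Coleman1979]
-/

noncomputable section

open scoped PowerSeries.WithPiTopology

namespace Literature.NumberTheory.GaloisRepresentations

section LocalFieldTZ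

open GaloisRepresentations.IsNonarchimedeanLocalField LubinTate ValuativeRel Filter

variable (F : Type*) [Field F] [ValuativeRel F] [TopologicalSpace F] [IsNonarchimedeanLocalField F]

attribute [local instance] ltNormUniformSpace ltNormIsUniformAddGroup rk1 nF nE fintypeResidueField

variable {F}
variable {π : 𝒪[F]} (hπ : (valuation F).IsUniformizer (π : F)) (n : ℕ)

/-! ### `𝒮(h ∘ f) = q · h` -/

/-- At points: `(𝒮(h ∘ f))([π]x) = Σ_c h([π](x [+] ω_c)) = q · h([π]x)`. [cite: deShalit1987, Ch. I §3.3 (7')] -/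
theorem evalAt_ltSMul_colemanTrace_subst_ltSer (h : PowerSeries (LTCoeff F))
    (x : (maxNilIdeal F (ltField π n)).toIdeal) :
    evalAt (maxNilIdeal F (ltField π n)) (ltSMul (maxNilIdeal F (ltField π n)) (isLTRing_LTCoeff hπ)
        (isLTSeries_LTCoeff π) (LTCoeff.of F π) x) (colemanTrace hπ n (PowerSeries.subst (ltSer F π) h)) =
      evalAt (maxNilIdeal F (ltField π n)) (ltSMul (maxNilIdeal F (ltField π n)) (isLTRing_LTCoeff hπ)
        (isLTSeries_LTCoeff π) (LTCoeff.of F π) x)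
        (PowerSeries.C (residueFieldCard F : LTCoeff F) * h) := by
  rw [evalAt_ltSMul_colemanTrace]
  have hf : PowerSeries.subst (ltSer F π) h = PowerSeries.subst
      (hom (isLTRing_LTCoeff hπ) (isLTSeries_LTCoeff π) (isLTSeries_LTCoeff π) (LTCoeff.of F π)) h := by
    rw [hom_self_eq]
  have e : ∀ c : 𝓀[F], evalAt (maxNilIdeal F (ltField π n)) (ltAdd (maxNilIdeal F (ltField π n))
      (isLTRing_LTCoeff hπ) (isLTSeries_LTCoeff π) x (ltDivPt hπ n c)) (PowerSeries.subst (ltSer F π) h) =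
      evalAt (maxNilIdeal F (ltField π n)) (ltSMul (maxNilIdeal F (ltField π n)) (isLTRing_LTCoeff hπ)
        (isLTSeries_LTCoeff π) (LTCoeff.of F π) x) h := by
    intro c
    rw [hf, evalAt_subst_hom hπ, ltSMul_ltAdd, ltSMul_ltDivPt, ltAdd_zero]
  simp_rw [e]
  rw [Finset.sum_const, Finset.card_univ, map_mul, PowerSeries.C_eq_algebraMap, AlgHom.commutes,
    show Fintype.card 𝓀[F] = residueFieldCard F by rw [residueFieldCard, Nat.card_eq_fintype_card],
    nsmul_eq_mul, map_natCast]

/-- ★ **`𝒮(h ∘ f) = q · h`** for every `h ∈ 𝒪[F]⟦X⟧` (`q = |𝓀_F|`): the translates of `h ∘ f = h ∘ [π]` by the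
`π`-division points all equal `h ∘ [π]`. [cite: deShalit1987, Ch. I §3.3 (7')] -/
theorem colemanTrace_subst_ltSer (h : PowerSeries (LTCoeff F)) :
    colemanTrace hπ n (PowerSeries.subst (ltSer F π) h) = PowerSeries.C (residueFieldCard F : LTCoeff F) * h := by
  refine eq_of_frequently_evalAt_ltSMul_genPt_eq hπ (fun m => (cohUnit hπ m : 𝒪[F]))
    (fun m => (cohUnit hπ m).isUnit) (Filter.Frequently.of_forall fun m => ?_)
  change evalAt (maxNilIdeal F (ltField π m)) (cohPt hπ m) _ = evalAt (maxNilIdeal F (ltField π m)) (cohPt hπ m) _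
  have hle := ltField_le_succ hπ m
  apply inclUnitBall_injective hle
  rw [inclUnitBall_evalAt hle, inclUnitBall_evalAt hle, ← ltAct_pi_cohPt_succ hπ m,
    colemanTrace_level_eq hπ n (m + 1), ltAct]
  exact evalAt_ltSMul_colemanTrace_subst_ltSer hπ (m + 1) h (cohPt hπ (m + 1))

/-! ### `(π, X)`-adic estimates for `∘ f` -/

omit [TopologicalSpace F] [IsNonarchimedeanLocalField F] in
/-- `I_0 = 𝒪[F]⟦X⟧`. [cite: deShalit1987, Ch. I §3.13 (proof)] -/
theorem mem_adicFilt_zero (V : PowerSeries (LTCoeff F)) : V ∈ adicFilt π 0 := fun k => by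
  rw [Nat.zero_sub, pow_zero, Ideal.span_singleton_one]; exact Submodule.mem_top

omit [TopologicalSpace F] [IsNonarchimedeanLocalField F] in
/-- A constant `c ∈ (π^j)` lies in `I_j`. [cite: deShalit1987, Ch. I §3.13 (proof)] -/
theorem C_mem_adicFilt {j : ℕ} {c : LTCoeff F} (hc : c ∈ Ideal.span {LTCoeff.of F π ^ j}) :
    PowerSeries.C c ∈ adicFilt π j := by
  intro k
  rw [PowerSeries.coeff_C]
  split_ifs with hk
  · subst hk; rwa [Nat.sub_zero]
  · exact zero_mem _

omit [TopologicalSpace F] [IsNonarchimedeanLocalField F] in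
/-- A series without constant term lies in `I_1`. [cite: deShalit1987, Ch. I §3.13 (proof)] -/
theorem mem_adicFilt_one_of_constantCoeff_eq_zero {d : PowerSeries (LTCoeff F)} (hd : PowerSeries.constantCoeff d = 0) :
    d ∈ adicFilt π 1 := by
  intro k
  rcases Nat.eq_zero_or_pos k with rfl | hk
  · rw [PowerSeries.coeff_zero_eq_constantCoeff, hd]; exact zero_mem _
  · rw [show 1 - k = 0 by omega, pow_zero, Ideal.span_singleton_one]; exact Submodule.mem_top

omit [TopologicalSpace F] [IsNonarchimedeanLocalField F] in
/-- The shift `(d − d(0))/X` of `d ∈ I_N` lies in `I_{N−1}`. [cite: deShalit1987, Ch. I §3.13 (proof)] -/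
theorem shift_mem_adicFilt {N : ℕ} {d : PowerSeries (LTCoeff F)} (hd : d ∈ adicFilt π N) :
    (PowerSeries.mk fun p => PowerSeries.coeff (p + 1) d) ∈ adicFilt π (N - 1) := fun k => by
  rw [PowerSeries.coeff_mk, show N - 1 - k = N - (k + 1) by omega]; exact hd (k + 1)

/-- `f ∈ I_1`. [cite: deShalit1987, Ch. I §3.13 (proof)] -/
theorem ltSer_mem_adicFilt_one : ltSer F π ∈ adicFilt π 1 :=
  mem_adicFilt_one_of_constantCoeff_eq_zero (isLTSeries_ltSer π).constantCoeff_eq_zero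

/-- `c ∈ (π^N) ⟹ c · f ∈ I_{N+2}` (`c π X ∈ I_{N+2}` and `c X^q ∈ I_{N+q} ⊆ I_{N+2}`). [cite: deShalit1987, Ch. I §3.13 (proof)] -/
theorem C_mul_ltSer_mem_adicFilt {N : ℕ} {c : LTCoeff F} (hc : c ∈ Ideal.span {LTCoeff.of F π ^ N}) :
    PowerSeries.C c * ltSer F π ∈ adicFilt π (N + 2) := by
  intro k
  rw [PowerSeries.coeff_C_mul]
  rcases Nat.lt_trichotomy k 1 with hk | rfl | hk
  · have hk0 : k = 0 := by omega
    subst hk0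
    rw [PowerSeries.coeff_zero_eq_constantCoeff, (isLTSeries_ltSer π).constantCoeff_eq_zero, mul_zero]
    exact zero_mem _
  · rw [(isLTSeries_ltSer π).coeff_one, show N + 2 - 1 = N + 1 by omega, pow_succ]
    exact Ideal.mem_span_singleton.mpr (mul_dvd_mul_right (Ideal.mem_span_singleton.mp hc) _)
  · exact Ideal.mul_mem_right _ _ (Ideal.mem_span_singleton.mpr
      (dvd_trans (pow_dvd_pow _ (by omega)) (Ideal.mem_span_singleton.mp hc)))

/-- `f` is substitutable (`f(0) = 0`). [folklore] -/
private theorem hasSubst_ltSer : PowerSeries.HasSubst (ltSer F π) :=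
  PowerSeries.HasSubst.of_constantCoeff_zero' (isLTSeries_ltSer π).constantCoeff_eq_zero

/-- ★ **`∘ f` raises the filtration on series without constant term**: `d ∈ I_N`, `d(0) = 0 ⟹ d ∘ f ∈ I_{N+1}`
(the coefficient `c_k X^k`, `c_k ∈ (π^{N−k})`, `k ≥ 1`, becomes `c_k (πX + X^q)^k ∈ I_{N+1}`).
[cite: deShalit1987, Ch. I §3.13 (proof)] -/
theorem subst_ltSer_mem_adicFilt_succ : ∀ (N : ℕ) {d : PowerSeries (LTCoeff F)}, d ∈ adicFilt π N →
    PowerSeries.constantCoeff d = 0 → PowerSeries.subst (ltSer F π) d ∈ adicFilt π (N + 1) := by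
  intro N
  induction N with
  | zero =>
    intro d _ hd0
    -- `d = X · d'`, `d ∘ f = f · (d' ∘ f) ∈ I_1`
    have e := PowerSeries.eq_X_mul_shift_add_const d
    rw [hd0, map_zero, add_zero] at e
    rw [e, PowerSeries.subst_mul hasSubst_ltSer, PowerSeries.subst_X hasSubst_ltSer]
    simpa using mul_mem_adicFilt (π := π) ltSer_mem_adicFilt_one (mem_adicFilt_zero (π := π) _)
  | succ N ih =>
    intro d hd hd0
    set d' : PowerSeries (LTCoeff F) := PowerSeries.mk fun p => PowerSeries.coeff (p + 1) d with hd'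
    have hd'mem : d' ∈ adicFilt π N := by simpa using shift_mem_adicFilt (π := π) hd
    have e := PowerSeries.eq_X_mul_shift_add_const d
    rw [hd0, map_zero, add_zero] at e
    -- `d' = e' + C c` with `c = d'(0) ∈ (π^N)`, `e' ∈ I_N`, `e'(0) = 0`
    set c : LTCoeff F := PowerSeries.constantCoeff d' with hc
    have hcmem : c ∈ Ideal.span {LTCoeff.of F π ^ N} := by
      have := hd'mem 0
      rwa [Nat.sub_zero, PowerSeries.coeff_zero_eq_constantCoeff] at this
    set e' : PowerSeries (LTCoeff F) := d' - PowerSeries.C c with he'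
    have he'mem : e' ∈ adicFilt π N := sub_mem hd'mem (C_mem_adicFilt hcmem)
    have he'0 : PowerSeries.constantCoeff e' = 0 := by
      rw [he', map_sub, PowerSeries.constantCoeff_C, hc, sub_self]
    have hd'eq : d' = e' + PowerSeries.C c := by rw [he', sub_add_cancel]
    have key : PowerSeries.subst (ltSer F π) d =
        ltSer F π * PowerSeries.subst (ltSer F π) e' + PowerSeries.C c * ltSer F π := by
      rw [e, PowerSeries.subst_mul hasSubst_ltSer, PowerSeries.subst_X hasSubst_ltSer]
      change ltSer F π * PowerSeries.subst (ltSer F π) d' = _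
      rw [hd'eq, PowerSeries.subst_add hasSubst_ltSer, PowerSeries.subst_C]
      change ltSer F π * (PowerSeries.subst (ltSer F π) e' + PowerSeries.C c) = _
      ring
    rw [key]
    refine add_mem ?_ (C_mul_ltSer_mem_adicFilt hcmem)
    have := mul_mem_adicFilt (π := π) ltSer_mem_adicFilt_one (ih he'mem he'0)
    rwa [show 1 + (N + 1) = N + 1 + 1 by ring] at this

/-! ### `(π, X)`-adic limits -/

include hπ in
/-- ★ **`(π, X)`-adically Cauchy sequences converge**: if `s_{N+1} − s_N ∈ I_{N+1}` for all `N`, there is `H` with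
`H − s_N ∈ I_{N+1}` for all `N` (coefficientwise `π`-adic limits; `𝒪[F]` is `π`-adically complete).
[cite: deShalit1987, Ch. I §3.12 Corollary (proof)] -/
theorem exists_forall_sub_mem_adicFilt (s : ℕ → PowerSeries (LTCoeff F))
    (hs : ∀ N, s (N + 1) - s N ∈ adicFilt π (N + 1)) :
    ∃ H : PowerSeries (LTCoeff F), ∀ N, H - s N ∈ adicFilt π (N + 1) := by
  have hle : ∀ {N M : ℕ}, N ≤ M → s M - s N ∈ adicFilt π (N + 1) := by
    intro N M hNM
    induction M, hNM using Nat.le_induction with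
    | base => rw [sub_self]; exact zero_mem _
    | succ M hNM ih =>
      have e : s (M + 1) - s N = (s (M + 1) - s M) + (s M - s N) := by ring
      rw [e]
      exact add_mem (adicFilt_mono (by omega) (hs M)) ih
  have hcoef : ∀ k : ℕ, ∃ L : LTCoeff F, ∀ N : ℕ,
      PowerSeries.coeff k (s (N + k)) ≡ L [SMOD (Ideal.span {LTCoeff.of F π} ^ N • ⊤ : Submodule (LTCoeff F) (LTCoeff F))] := by
    intro k
    refine (isPrecomplete_LTCoeff hπ).prec' (fun N => PowerSeries.coeff k (s (N + k))) fun {M N} hMN => ?_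
    rw [SModEq.sub_mem, smul_eq_mul, Ideal.mul_top, Ideal.span_singleton_pow, ← neg_sub, neg_mem_iff, ← map_sub]
    have hmem := hle (show M + k ≤ N + k by omega) k
    exact Ideal.mem_span_singleton.mpr (dvd_trans (pow_dvd_pow _ (by omega)) (Ideal.mem_span_singleton.mp hmem))
  choose L hL using hcoef
  refine ⟨PowerSeries.mk L, fun N k => ?_⟩
  rw [map_sub, PowerSeries.coeff_mk]
  rcases Nat.lt_or_ge (N + 1) k with hlt | hge
  · rw [show N + 1 - k = 0 by omega, pow_zero, Ideal.span_singleton_one]; exact Submodule.mem_top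
  · have h1 := hL k (N + 1 - k)
    rw [SModEq.sub_mem, smul_eq_mul, Ideal.mul_top, Ideal.span_singleton_pow,
      show N + 1 - k + k = N + 1 by omega] at h1
    have h2 := hs N k
    rw [map_sub] at h2
    rw [show L k - PowerSeries.coeff k (s N) = (PowerSeries.coeff k (s (N + 1)) - PowerSeries.coeff k (s N)) -
      (PowerSeries.coeff k (s (N + 1)) - L k) by ring]
    exact sub_mem h2 h1

/-! ### The fixed point `h = g + u · (h ∘ f)` -/

variable (π) in
/-- The approximants `h_0 = 0`, `h_{M+1} = g + u · (h_M ∘ f)` (so `h_M = Σ_{i<M} u^i · g ∘ f^{(i)}`).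
[cite: deShalit1987, Ch. I §3.13 (proof)] -/
def fixSeq (u : LTCoeff F) (g : PowerSeries (LTCoeff F)) : ℕ → PowerSeries (LTCoeff F)
  | 0 => 0
  | M + 1 => g + PowerSeries.C u * PowerSeries.subst (ltSer F π) (fixSeq u g M)

/-- Unfolding. [cite: deShalit1987, Ch. I §3.13 (proof)] -/
theorem fixSeq_succ (u : LTCoeff F) (g : PowerSeries (LTCoeff F)) (M : ℕ) :
    fixSeq π u g (M + 1) = g + PowerSeries.C u * PowerSeries.subst (ltSer F π) (fixSeq π u g M) := rfl

/-- `(h ∘ f)(0) = h(0)`. [cite: deShalit1987, Ch. I §3.13 (proof)] -/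
theorem constantCoeff_subst_ltSer (h : PowerSeries (LTCoeff F)) :
    PowerSeries.constantCoeff (PowerSeries.subst (ltSer F π) h) = PowerSeries.constantCoeff h := by
  have e := PowerSeries.eq_X_mul_shift_add_const h
  conv_lhs => rw [e]
  rw [PowerSeries.subst_add hasSubst_ltSer, PowerSeries.subst_mul hasSubst_ltSer, PowerSeries.subst_X hasSubst_ltSer,
    PowerSeries.subst_C]
  change PowerSeries.constantCoeff (ltSer F π * _ + PowerSeries.C _) = _
  rw [map_add, map_mul, (isLTSeries_ltSer π).constantCoeff_eq_zero, zero_mul, zero_add, PowerSeries.constantCoeff_C]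

/-- `h_M(0) = 0` when `g(0) = 0`. [cite: deShalit1987, Ch. I §3.13 (proof)] -/
theorem constantCoeff_fixSeq (u : LTCoeff F) {g : PowerSeries (LTCoeff F)} (hg : PowerSeries.constantCoeff g = 0) :
    ∀ M, PowerSeries.constantCoeff (fixSeq π u g M) = 0
  | 0 => by simp [fixSeq]
  | M + 1 => by
    rw [fixSeq_succ, map_add, map_mul, constantCoeff_subst_ltSer, constantCoeff_fixSeq u hg M, mul_zero, add_zero, hg]

/-- `h_{M+1} − h_M ∈ I_{M+1}` (indeed `= u^M g ∘ f^{(M)}`). [cite: deShalit1987, Ch. I §3.13 (proof)] -/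
theorem fixSeq_succ_sub_mem (u : LTCoeff F) {g : PowerSeries (LTCoeff F)} (hg : PowerSeries.constantCoeff g = 0) :
    ∀ M, fixSeq π u g (M + 1) - fixSeq π u g M ∈ adicFilt π (M + 1)
  | 0 => by
    rw [fixSeq_succ]
    simp only [fixSeq]
    rw [← PowerSeries.coe_substAlgHom hasSubst_ltSer, map_zero, mul_zero, add_zero, sub_zero]
    exact mem_adicFilt_one_of_constantCoeff_eq_zero hg
  | M + 1 => by
    have e : fixSeq π u g (M + 1 + 1) - fixSeq π u g (M + 1) =
        PowerSeries.C u * PowerSeries.subst (ltSer F π) (fixSeq π u g (M + 1) - fixSeq π u g M) := by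
      rw [fixSeq_succ, fixSeq_succ, ← PowerSeries.coe_substAlgHom hasSubst_ltSer, map_sub]; ring
    rw [e]
    refine Ideal.mul_mem_left _ _ (subst_ltSer_mem_adicFilt_succ (M + 1) (fixSeq_succ_sub_mem u hg M) ?_)
    rw [map_sub, constantCoeff_fixSeq u hg, constantCoeff_fixSeq u hg, sub_zero]

include hπ in
/-- ★★ **The equation `h = g + u · (h ∘ f)` has a solution with `h(0) = 0`** for every `g` with `g(0) = 0` and every
constant `u ∈ 𝒪[F]` (`h = Σ_i u^i · g ∘ f^{(i)}`, a `(π, X)`-adic limit). [cite: deShalit1987, Ch. I §3.13] -/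
theorem exists_eq_add_C_mul_subst (u : LTCoeff F) {g : PowerSeries (LTCoeff F)} (hg : PowerSeries.constantCoeff g = 0) :
    ∃ h : PowerSeries (LTCoeff F), PowerSeries.constantCoeff h = 0 ∧
      h = g + PowerSeries.C u * PowerSeries.subst (ltSer F π) h := by
  obtain ⟨H, hH⟩ := exists_forall_sub_mem_adicFilt hπ (fixSeq π u g) (fixSeq_succ_sub_mem u hg)
  have hH0 : PowerSeries.constantCoeff H = 0 := by
    refine LTCoeff.eq_zero_of_forall_mem_span_pow_succ hπ fun i => ?_
    have := hH i 0
    rwa [Nat.sub_zero, map_sub, PowerSeries.coeff_zero_eq_constantCoeff,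
      constantCoeff_fixSeq u hg, sub_zero] at this
  refine ⟨H, hH0, ?_⟩
  rw [← sub_eq_zero]
  refine eq_zero_of_forall_mem_adicFilt hπ fun N => ?_
  have e : H - (g + PowerSeries.C u * PowerSeries.subst (ltSer F π) H) =
      (H - fixSeq π u g (N + 1)) - PowerSeries.C u * PowerSeries.subst (ltSer F π) (H - fixSeq π u g N) := by
    rw [fixSeq_succ, ← PowerSeries.coe_substAlgHom hasSubst_ltSer, map_sub]; ring
  rw [e]
  refine adicFilt_mono (by omega) (sub_mem (hH (N + 1)) (Ideal.mul_mem_left _ _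
    (subst_ltSer_mem_adicFilt_succ (N + 1) (hH N) ?_)))
  rw [map_sub, hH0, constantCoeff_fixSeq u hg, sub_zero]

include hπ in
/-- ★ **Uniqueness**: two solutions of `h = g + u · (h ∘ f)` with the same constant term coincide (their difference
`d` satisfies `d = u · (d ∘ f)`, `d(0) = 0`, so `d ∈ ⋂ I_N = 0`). [cite: deShalit1987, Ch. I §3.14] -/
theorem eq_of_eq_add_C_mul_subst (u : LTCoeff F) {g h h' : PowerSeries (LTCoeff F)}
    (hh : h = g + PowerSeries.C u * PowerSeries.subst (ltSer F π) h)
    (hh' : h' = g + PowerSeries.C u * PowerSeries.subst (ltSer F π) h')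
    (h0 : PowerSeries.constantCoeff h = PowerSeries.constantCoeff h') : h = h' := by
  rw [← sub_eq_zero]
  set d := h - h' with hd
  have hdfix : d = PowerSeries.C u * PowerSeries.subst (ltSer F π) d := by
    rw [hd, ← PowerSeries.coe_substAlgHom hasSubst_ltSer, map_sub, PowerSeries.coe_substAlgHom]
    conv_lhs => rw [hh, hh']
    ring
  have hd0 : PowerSeries.constantCoeff d = 0 := by rw [hd, map_sub, h0, sub_self]
  have hmem : ∀ N, d ∈ adicFilt π N := by
    intro N
    induction N with
    | zero => exact mem_adicFilt_zero _
    | succ N ih => rw [hdfix]; exact Ideal.mul_mem_left _ _ (subst_ltSer_mem_adicFilt_succ N ih hd0)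
  exact eq_zero_of_forall_mem_adicFilt hπ hmem

/-! ### Traces -/

/-- ★★ **`𝒮h = 𝒮g + (u q) · h`** for a solution of `h = g + u · (h ∘ f)`. [cite: deShalit1987, Ch. I §3.13] -/
theorem colemanTrace_eq_of_eq_add_C_mul_subst (u : LTCoeff F) {g h : PowerSeries (LTCoeff F)}
    (hh : h = g + PowerSeries.C u * PowerSeries.subst (ltSer F π) h) :
    colemanTrace hπ n h = colemanTrace hπ n g + PowerSeries.C (u * residueFieldCard F) * h := by
  conv_lhs => rw [hh]
  rw [colemanTrace_add, colemanTrace_C_mul, colemanTrace_subst_ltSer, ← mul_assoc, ← map_mul]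

/-- ★★ **When `π = q · u`: `𝒮h = π h ⟺ 𝒮g = 0`** for a solution of `h = g + u · (h ∘ f)`.
[cite: deShalit1987, Ch. I §3.13] -/
theorem colemanTrace_eq_iff_colemanTrace_eq_zero {u : LTCoeff F} (hu : LTCoeff.of F π = residueFieldCard F * u)
    {g h : PowerSeries (LTCoeff F)} (hh : h = g + PowerSeries.C u * PowerSeries.subst (ltSer F π) h) :
    colemanTrace hπ n h = PowerSeries.C (LTCoeff.of F π) * h ↔ colemanTrace hπ n g = 0 := by
  rw [colemanTrace_eq_of_eq_add_C_mul_subst hπ n u hh, hu, mul_comm (residueFieldCard F : LTCoeff F) u]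
  exact ⟨fun h1 => add_eq_right.mp h1, fun h1 => by rw [h1, zero_add]⟩

/-! ### `h ↦ h̃ = h − u · (h ∘ f)` -/

variable (π) in
/-- **De Shalit's `h̃ = h − u · (h ∘ f)`** (for `𝔾̂_m` and `u = 1`: `h̃ = h − h ∘ [p]`, I §3.3 (7')).
[cite: deShalit1987, Ch. I §3.3 (7')] -/
def tildeSer (u : LTCoeff F) (h : PowerSeries (LTCoeff F)) : PowerSeries (LTCoeff F) :=
  h - PowerSeries.C u * PowerSeries.subst (ltSer F π) h

/-- Unfolding. [cite: deShalit1987, Ch. I §3.3 (7')] -/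
theorem tildeSer_def (u : LTCoeff F) (h : PowerSeries (LTCoeff F)) :
    tildeSer π u h = h - PowerSeries.C u * PowerSeries.subst (ltSer F π) h := rfl

/-- `h ↦ h̃` is additive. [cite: deShalit1987, Ch. I §3.3] -/
theorem tildeSer_add (u : LTCoeff F) (h h' : PowerSeries (LTCoeff F)) :
    tildeSer π u (h + h') = tildeSer π u h + tildeSer π u h' := by
  rw [tildeSer_def, tildeSer_def, tildeSer_def, PowerSeries.subst_add hasSubst_ltSer]; ring

/-- `h ↦ h̃` is `𝒪[F]`-linear. [cite: deShalit1987, Ch. I §3.3] -/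
theorem tildeSer_C_mul (u a : LTCoeff F) (h : PowerSeries (LTCoeff F)) :
    tildeSer π u (PowerSeries.C a * h) = PowerSeries.C a * tildeSer π u h := by
  rw [tildeSer_def, tildeSer_def, subst_C_mul (isLTSeries_ltSer π)]; ring

/-- `h̃(0) = (1 − u) h(0)`. [cite: deShalit1987, Ch. I §3.3] -/
theorem constantCoeff_tildeSer (u : LTCoeff F) (h : PowerSeries (LTCoeff F)) :
    PowerSeries.constantCoeff (tildeSer π u h) = (1 - u) * PowerSeries.constantCoeff h := by
  rw [tildeSer_def, map_sub, map_mul, constantCoeff_subst_ltSer, PowerSeries.constantCoeff_C]; ring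

/-- **`𝒮h̃ = 𝒮h − (u q) · h`.** [cite: deShalit1987, Ch. I §3.13] -/
theorem colemanTrace_tildeSer (u : LTCoeff F) (h : PowerSeries (LTCoeff F)) :
    colemanTrace hπ n (tildeSer π u h) = colemanTrace hπ n h - PowerSeries.C (u * residueFieldCard F) * h := by
  rw [tildeSer_def, colemanTrace_sub, colemanTrace_C_mul, colemanTrace_subst_ltSer, ← mul_assoc, ← map_mul]

/-- ★★ **`π = q u`, `𝒮h = πh ⟹ 𝒮h̃ = 0`**: `h ↦ h̃` maps `𝓔_π` into the trace-zero series.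
[cite: deShalit1987, Ch. I §3.14] -/
theorem colemanTrace_tildeSer_eq_zero {u : LTCoeff F} (hu : LTCoeff.of F π = residueFieldCard F * u)
    {h : PowerSeries (LTCoeff F)} (hh : colemanTrace hπ n h = PowerSeries.C (LTCoeff.of F π) * h) :
    colemanTrace hπ n (tildeSer π u h) = 0 := by
  rw [colemanTrace_tildeSer, hh, hu, mul_comm (residueFieldCard F : LTCoeff F) u, sub_self]

include hπ in
/-- ★★★ **De Shalit I §3.13–3.14 on the power-series side (`π = q u`)**: every `g ∈ 𝒪[F]⟦X⟧` with `𝒮g = 0` and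
`g(0) = 0` is `h̃` for a UNIQUE `h` with `h(0) = 0`, and that `h` lies in `𝓔_π` (`𝒮h = πh`).
[cite: deShalit1987, Ch. I §3.13 Lemma] -/
theorem existsUnique_tildeSer_eq {u : LTCoeff F} (hu : LTCoeff.of F π = residueFieldCard F * u)
    {g : PowerSeries (LTCoeff F)} (hg : colemanTrace hπ n g = 0) (hg0 : PowerSeries.constantCoeff g = 0) :
    ∃! h : PowerSeries (LTCoeff F), PowerSeries.constantCoeff h = 0 ∧ tildeSer π u h = g ∧
      colemanTrace hπ n h = PowerSeries.C (LTCoeff.of F π) * h := by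
  obtain ⟨h, hh0, hh⟩ := exists_eq_add_C_mul_subst hπ u hg0
  have htilde : tildeSer π u h = g := by
    rw [tildeSer_def]
    nth_rewrite 1 [hh]
    ring
  refine ⟨h, ⟨hh0, htilde, (colemanTrace_eq_iff_colemanTrace_eq_zero hπ n hu hh).mpr hg⟩, ?_⟩
  rintro h' ⟨hh'0, hh', -⟩
  refine eq_of_eq_add_C_mul_subst hπ u (g := g) ?_ hh (by rw [hh'0, hh0])
  rw [← hh', tildeSer_def]; ring

include hπ in
/-- ★★ **`h ↦ h̃` is injective on series with a fixed constant term** (in particular on `{h : h(0) = 0}`; for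
`u ≠ 1` even `h̃ = 0 ⟹ h = h(0)·(…)` is forced to vanish). [cite: deShalit1987, Ch. I §3.14] -/
theorem tildeSer_injective_of_constantCoeff_eq (u : LTCoeff F) {h h' : PowerSeries (LTCoeff F)}
    (he : tildeSer π u h = tildeSer π u h') (h0 : PowerSeries.constantCoeff h = PowerSeries.constantCoeff h') :
    h = h' :=
  eq_of_eq_add_C_mul_subst hπ u (g := tildeSer π u h) (by rw [tildeSer_def]; ring) (by rw [he, tildeSer_def]; ring) h0

end LocalFieldTZ

end Literature.NumberTheory.GaloisRepresentations
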